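import Summits.ValiantsHypothesis.ValiantsHypothesis.Theorems.SymPencilSdcPerFourTwentyEight
import Summits.ValiantsHypothesis.ValiantsHypothesis.Theorems.SymPencilPerFourPeeledEleven
import Summits.ValiantsHypothesis.ValiantsHypothesis.Theorems.SymPencilSdcPerFourCellNineSevenTwentyEight
import Summits.ValiantsHypothesis.ValiantsHypothesis.Theorems.SymPencilSdcPerFourCellTenSevenClosed
import Summits.ValiantsHypothesis.ValiantsHypothesis.Theorems.SymPencilSdcPerFourCellElevenFiveTwentyEightClosed
import Summits.ValiantsHypothesis.ValiantsHypothesis.Theorems.SymPencilSdcPerFourCellTwelveFourTwentyEight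
import Summits.ValiantsHypothesis.ValiantsHypothesis.Theorems.SymPencilSdcPerFourCellThirteenThreeToricTwentyEight

/-!
# Route `SymPencil` — `sdc(per_4) = 29`, UNCONDITIONAL over every field of characteristic `0`:
# the size-28 table assembled
# (`--supports` stmt-ValiantsHypothesis-5674 `SdcSuperquadratic`; rung currency only — nothing
# here bears on `VP ≠ VNP`)

Assembly, in the pattern of ✓ `…SdcPerFourTwentyEight` (the size-`27` table), of the six cells of
the size-`28` kernel-package table.  In the base-point package
(`…BasePointPackage.basepoint_package_of_isSymm_isAffineDetRepr_perPoly_four`) of a symmetric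
affine determinantal representation of `per_4` of size `m ≤ 28` the rank `r = dim (im bL)`
satisfies `8 ≤ r ≤ 13` (`2r ≤ m - 1 ≤ 27`, `dim ker ≤ 8`, `r + dim ker = 16`), and every value is
excluded by a landed cell theorem at `m ≤ 28`:

* `r = 8`:  `…PerFourPeeledEleven.false_of_rank_eight_le_twentyEight` (two-pencil coverage
  `genSwap_of_frameless` + the functional corner, inner rank `≥ 12`);
* `r = 9`:  `…CellNineSevenTwentyEight.false_of_rank_nine_le_twentyEight` (isotropic pair rank
  + the cross `X₉₇₉`);
* `r = 10`: `…CellTenSevenClosed.false_of_rank_ten_le_twentyEight` (`IsAlgClosed`; THE LIST at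
  seven squares);
* `r = 11`: `…CellElevenFiveTwentyEight.false_of_rank_eleven_le_twentyEight` (the `Sing₃`
  five-classification at five squares: zero-row bridge, leaf X, leaf E, torus bricks);
* `r = 12`: `…CellTwelveFourTwentyEight.false_of_rank_twelve_le_twentyEight` (`IsAlgClosed`);
* `r = 13`: `…CellThirteenThreeToricTwentyEight.false_of_rank_thirteen_le_twentyEight`
  (`IsAlgClosed`).

Hence `29 ≤ m` over an algebraically closed field of characteristic `0`
(`twentyNine_le_of_isAlgClosed`), and over ANY field of characteristic `0` by the descent
✓ `…BasePointDetConst.le_size_of_algebraicClosure`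
(`twentyNine_le_of_isSymm_isAffineDetRepr_perPoly_four`).  With the `29 × 29` pencil of
✓ `…SdcPerFourTwentyNine`: **`sdc(per₄) = 29`** (`sdc_perPoly_four_eq_twentyNine`).

Honest framing: the `n = 4` calibration VALUE for the aside item `SdcSuperquadratic` (which asks
for a superquadratic lower bound in `n` and stays OPEN); `VP ≠ VNP` is not moved; no summit
statement is proved here.  Credit: the six cells are the work of the val-lit / val-port cell
lanes named in the files above (p6, p8, port-3, port-4 and predecessors); this file only composes
them.  No definitions, no named facts. [folklore]
-/

noncomputable section

-- single-conjunct layout: Sub = Summit, duplicated namespace component intended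
set_option linter.dupNamespace false

namespace Summit.ValiantsHypothesis.ValiantsHypothesis.Theorems.SymPencilSdcPerFourEqTwentyNine

open Matrix MvPolynomial Module
open Literature.Computability.AlgebraicComplexity
open Summit.ValiantsHypothesis.ValiantsHypothesis.Theorems.SymPencilPerFourBasePointPackage
open Summit.ValiantsHypothesis.ValiantsHypothesis.Theorems.SymPencilBasePointDetConst

/-- **Every symmetric affine determinantal representation of `per_4` over an algebraically closed
field of characteristic `0` has size `≥ 29`** — the six cells of the size-`28` table. [folklore] -/
theorem twentyNine_le_of_isAlgClosed (K : Type*) [Field K] [CharZero K] [IsAlgClosed K]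
    {m : ℕ} {A : Matrix (Fin m) (Fin m) (MvPolynomial (Fin 4 × Fin 4) K)}
    (hS : A.IsSymm) (hA : IsAffineDetRepr (perPoly (Fin 4) K) A) : 29 ≤ m := by
  classical
  by_contra hlt
  have hm : m ≤ 28 := by omega
  obtain ⟨i₀, D, bL, CL, κ, hD, hDs, hCs, hκ, hi, hii, hiii, hV4, hcard, hranle, hrn, hkerle,
    hN⟩ := basepoint_package_of_isSymm_isAffineDetRepr_perPoly_four K hS hA
  have hr : finrank K (LinearMap.range bL) = 8 ∨ finrank K (LinearMap.range bL) = 9 ∨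
      finrank K (LinearMap.range bL) = 10 ∨ finrank K (LinearMap.range bL) = 11 ∨
      finrank K (LinearMap.range bL) = 12 ∨ finrank K (LinearMap.range bL) = 13 := by omega
  rcases hr with h8 | h9 | h10 | h11 | h12 | h13
  · exact SymPencilPerFourPeeledEleven.false_of_rank_eight_le_twentyEight K hm hD hDs hCs hκ hi hii
      hiii hV4 hcard hrn h8
  · exact SymPencilSdcPerFourCellNineSevenTwentyEight.false_of_rank_nine_le_twentyEight K hm hD
      hDs hCs hκ hi hii hiii hV4 hcard hrn h9
  · exact SymPencilSdcPerFourCellTenSevenClosed.false_of_rank_ten_le_twentyEight K hm hD hDs hCs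
      hκ hi hii hiii hV4 hcard hrn hN h10
  · exact SymPencilSdcPerFourCellElevenFiveTwentyEight.false_of_rank_eleven_le_twentyEight K hm hD
      hDs hCs hκ hi hii hiii hV4 hcard hranle hrn hN h11
  · exact SymPencilSdcPerFourCellTwelveFourTwentyEight.false_of_rank_twelve_le_twentyEight
      (K := K) hm hD hDs hCs hκ hi hii hiii hcard hrn hN h12
  · exact SymPencilSdcPerFourCellThirteenThreeToricTwentyEight.false_of_rank_thirteen_le_twentyEight
      K hm hD hDs hCs hκ hi hii hiii hcard hranle hrn hN h13

/-- **Every symmetric affine determinantal representation of `per_4` over a field of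
characteristic `0` has size `≥ 29`** (descent from the algebraic closure). [folklore] -/
theorem twentyNine_le_of_isSymm_isAffineDetRepr_perPoly_four (K : Type*) [Field K] [CharZero K]
    {m : ℕ} {A : Matrix (Fin m) (Fin m) (MvPolynomial (Fin 4 × Fin 4) K)}
    (hS : A.IsSymm) (hA : IsAffineDetRepr (perPoly (Fin 4) K) A) : 29 ≤ m :=
  le_size_of_algebraicClosure
    (fun _ _ hS' hA' => twentyNine_le_of_isAlgClosed (AlgebraicClosure K) hS' hA') hS hA

/-- **No symmetric affine determinantal representation of `per_4` has size `≤ 28`**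
(characteristic `0`). [folklore] -/
theorem false_of_isSymm_isAffineDetRepr_perPoly_four_le_twentyEight (K : Type*) [Field K]
    [CharZero K] {m : ℕ} (hm : m ≤ 28)
    {A : Matrix (Fin m) (Fin m) (MvPolynomial (Fin 4 × Fin 4) K)}
    (hS : A.IsSymm) (hA : IsAffineDetRepr (perPoly (Fin 4) K) A) : False := by
  have h := twentyNine_le_of_isSymm_isAffineDetRepr_perPoly_four K hS hA
  omega

/-- **`29 ≤ sdc(per₄)`** over any field of characteristic `0`. [folklore] -/
theorem twentyNine_le_sdc_perPoly_four (K : Type*) [Field K] [CharZero K] :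
    29 ≤ symmDeterminantalComplexity (perPoly (Fin 4) K) := by
  letI : Invertible (2 : K) := invertibleOfNonzero two_ne_zero
  obtain ⟨A, hS, hA⟩ :=
    hasSymmDetRepr_symmDeterminantalComplexity
      ⟨_, SymPencilSdcPerThreeWindow.hasSymmDetRepr_perPoly_quarez K 4⟩
  exact twentyNine_le_of_isSymm_isAffineDetRepr_perPoly_four K hS hA

/-- ★ **`sdc(per₄) = 29`** over any field of characteristic `0`: the symmetric determinantal
complexity of the `4 × 4` permanent (Grenet–Kaltofen–Koiran–Portier's `29 × 29` symmetric pencil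
✓ `…SdcPerFourTwentyNine` is optimal). [folklore] -/
theorem sdc_perPoly_four_eq_twentyNine (K : Type*) [Field K] [CharZero K] :
    symmDeterminantalComplexity (perPoly (Fin 4) K) = 29 :=
  le_antisymm (SymPencilSdcPerFourTwentyNine.sdc_perPoly_four_le_twentyNine K two_ne_zero)
    (twentyNine_le_sdc_perPoly_four K)

/-- The complex instance: `sdc(per₄) = 29` over `ℂ`. [folklore] -/
theorem sdc_perPoly_four_eq_twentyNine_complex :
    symmDeterminantalComplexity (perPoly (Fin 4) ℂ) = 29 :=
  sdc_perPoly_four_eq_twentyNine ℂ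

end Summit.ValiantsHypothesis.ValiantsHypothesis.Theorems.SymPencilSdcPerFourEqTwentyNine

end
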